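import Summits.Ventures.HSemireg.ObstructionLocusBlockGraded

/-!
# Venture HSemireg — (S5) OBSTRUCTION LOCUS away from secant type, XXIII: the WEIGHT COUNT of the normal module of a
# block model — **`dim_K Hom_R(I_M, R/I_M)_c = #{(i,a,b) : c_b = −1, c_a = 0, c ≥ 0 off {a,b}}` for EVERY `c ∈ ℤⁿ`**
# (EXT-NOTE §6.B(a)'s MACHINE-CHECK column as a theorem: every block model, every `n`; `Σ_l dim Hom_{−e_l} =
# 2 · #components`)

HONEST FRAMING.  Sequel of `ObstructionLocusBlockGraded.lean` (cell `pub-hsemireg`, track «S4-PUSH» (ii), seat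
s4-prove-2; vocabulary and honest framing as there and in files XV–XXI).  general-structure/EXT-NOTE.md §6.B ends
with «MACHINE CHECK of (a) (work/ext/homIA.py: `dim Hom_R(I,A)_c` … compared with the prediction of (a) degree by
degree): `K_3, K_4` (`c ∈ [−2,2]³, [−2,1]⁴`), `K_5, K_6` (`[−1,1]ⁿ`), `K_2⊔K_2` (n=4), `K_3⊔K_2` (n=5), `K_3⊔K_3` and
`K_2⊔K_2⊔K_2` (n=6), `K_4⊔K_3` (n=7, `[−1,0]⁷`): 3438 multidegrees, 0 mismatches; `Σ_l dim Hom_{−e_l} = 6, 12, 20, 30 |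
4, 8, 12, 6, 18 = 2·#components` each time» and «§6 turns these finite checks into theorems for all n, m, r».  THIS
FILE IS THAT THEOREM for the normal module: for every block structure (pairwise disjoint non-empty `S_i ⊂ [n]`), every
`n`, every multidegree `c ∈ ℤⁿ` and every field (indeed every non-trivial commutative ring) `K`, the weight-`c` piece
of `Hom_R(I_M, R/I_M)` — intrinsically defined in file XXII — has `K`-dimension the number of branch data
`(i, a, b)` (`a ∈ S_i`, `b ∈ S_i ∖ a`) with `c_b = −1`, `c_a = 0` and `c_l ≥ 0` for `l ∉ {a, b}`: the prediction of
§6.B(a) degree by degree.  Nothing here constructs a variety or a sheaf; nothing here says that HC / HC_CM / HC_AV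
holds; no Literature fact is declared or used; no object is certified; what stays prose / binder is as in file XXII.

PROVED HERE (kernel):
* `homWeight_le_span`, **`homWeight_eq_span`** — `Hom_c` is EXACTLY the `K`-span of the basis vectors `σ_{i,a,b}(x^u)`
  of weight `u − e_b = c` (group the basis expansion by weight; on each monomial of `I_M` the groups of weight `≠ c`
  land in independent weight lines, so they vanish on `I_M`); `iSup_homWeight_eq_top`, `iSupIndep_homWeight`,
  **`isInternal_homWeight`: `Hom_R(I_M, R/I_M) = ⨁_{c ∈ ℤⁿ} Hom_c`** (internal direct sum — the grading).
* `weightFiberEquiv` — basis vectors of weight `c` ↔ contributing branch data (`Contributes c (i,a,b)`: `c_b = −1`,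
  `c_a = 0`, `c ≥ 0` off `{a,b}`; the exponent is forced, `u = c + e_b`); hence
  **`finrank_homWeight`: `dim_K Hom_c = #{t ∈ Branch B : Contributes c t}`** (`K` non-trivial).
* «NO POLES» DEGREE BY DEGREE: `homWeight_eq_bot_of_le` (`Hom_c = 0` if some `c_l ≤ −2`), `homWeight_eq_bot_of_two_neg`
  (`Hom_c = 0` if two entries are negative), `homWeight_eq_bot_of_nonneg` (`Hom_c = 0` if `c ≥ 0`; `Hom_0 = 0`) — any
  commutative `K`.
* THE COLUMN: `contributes_negSingle_iff` (`(i,a,b)` contributes to `−e_l` iff `b = l`),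
  **`finrank_homWeight_negSingle_of_mem`: `dim_K Hom_{−e_l} = |S_i| − 1` for `l ∈ S_i`** (the fields `∂_l` on the
  components `V(x_a, x_l)`, `a ∈ S_i ∖ l`), `finrank_homWeight_negSingle_of_notMem` (`= 0` for a free coordinate),
  **`sum_finrank_homWeight_negSingle`: `Σ_l dim_K Hom_{−e_l} = Σ_i |S_i| (|S_i| − 1) = #Branch = 2 · #components`** —
  `n(n−1) = 6, 12, 20, 30` for `K_3, …, K_6` and `4, 8, 12, 6, 18` for the two- and three-block types above, now for all.
References (dictionary only): EXT-NOTE.md §6.0, §6.B(a) + MACHINE CHECK paragraph, §6.C(1) (`h(W) = n(n−1)`);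
STRUCTURE.md §2 (S5)/(S-B), hypothesis (H-arr); files XV–XXII of this series.
-/

open scoped BigOperators
open MvPolynomial Finset

namespace Summit.Ventures.HSemireg.ObstructionLocus.BlockModel

variable {K : Type*} [CommRing K] {n : ℕ} {ι : Type*}

/-- An `R`-linear `ψ : I_M → R/I_M` vanishing on the monic monomials of `I_M` is zero. -/
theorem hom_eq_zero_of_monomial (B : Blocks ι n)
    {ψ : ↥(arrIdeal K B) →ₗ[MvPolynomial (Fin n) K] MvPolynomial (Fin n) K ⧸ arrIdeal K B}
    (h : ∀ (v : Fin n →₀ ℕ) (hv : monomial v (1 : K) ∈ arrIdeal K B), ψ ⟨monomial v 1, hv⟩ = 0) : ψ = 0 := by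
  apply LinearMap.ext
  intro f
  rw [eq_sum_monomial_coeff B f, map_sum, LinearMap.zero_apply]
  refine Finset.sum_eq_zero fun v hv => ?_
  have hv1 : monomial v (1 : K) ∈ arrIdeal K B :=
    mem_arrIdeal_iff.2 fun i => monomial_mem_blockIdeal ((mem_arrIdeal_iff'.1 f.2) v hv i) 1
  have : (⟨monomial v (coeff v f.1), monomial_coeff_mem B f.2 v⟩ : ↥(arrIdeal K B))
      = (C (coeff v f.1) : MvPolynomial (Fin n) K) • ⟨monomial v 1, hv1⟩ := by
    apply Subtype.ext
    change monomial v (coeff v f.1) = C (coeff v f.1) * monomial v 1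
    rw [C_mul_monomial, mul_one]
  rw [this, map_smul, h v hv1, smul_zero]

variable [Fintype ι] [DecidableEq ι]

/-! ## The weight decomposition -/

/-- **THE WEIGHT PIECE `Hom_c` IS SPANNED BY THE BASIS VECTORS OF WEIGHT `c`.**  If `φ(x^v) ∈ K·[x^{v+c}]` for every
monomial `x^v ∈ I_M`, expand `φ = Σ_j r_j σ_j` in the monomial basis and group by weight: on each `x^v` the groups
of weight `d ≠ c` land in the independent lines `K·[x^{v+d}]`, so they vanish on every monomial of `I_M`, hence
vanish. -/
theorem homWeight_le_span (B : Blocks ι n) (c : Fin n → ℤ) :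
    homWeight K B c ≤ Submodule.span K (Set.range fun j : {j : HomIndex B // j.weight = c} => homBasis B j.1) := by
  classical
  intro φ hφ
  set r := (homBasis (K := K) B).repr φ with hr
  set F := r.support with hF
  set D : Finset (Fin n → ℤ) := F.image HomIndex.weight with hD
  -- the weight-`d` group of the expansion of `φ`
  set ψ : (Fin n → ℤ) → (↥(arrIdeal K B) →ₗ[MvPolynomial (Fin n) K] MvPolynomial (Fin n) K ⧸ arrIdeal K B) :=
    fun d => ∑ j ∈ F.filter (fun j => j.weight = d), r j • homBasis B j with hψ
  have hψmem : ∀ d, ψ d ∈ homWeight K B d := by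
    intro d
    refine Submodule.sum_mem _ fun j hj => Submodule.smul_mem _ _ ?_
    rw [← (Finset.mem_filter.1 hj).2]
    exact homBasis_mem_homWeight B j
  have hsum : φ = ∑ d ∈ D, ψ d := by
    conv_lhs => rw [← (homBasis (K := K) B).linearCombination_repr φ, Finsupp.linearCombination_apply, Finsupp.sum]
    exact (Finset.sum_fiberwise_of_maps_to (fun j hj => Finset.mem_image_of_mem HomIndex.weight hj) _).symm
  have hzero : ∀ d ∈ D, d ≠ c → ψ d = 0 := by
    intro d hd hdc
    apply hom_eq_zero_of_monomial B
    intro v hv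
    have h1 : ∑ d' ∈ D, ψ d' ⟨monomial v 1, hv⟩ ∈ weightLine K B c v := by
      have := LinearMap.congr_fun hsum ⟨monomial v 1, hv⟩
      rw [LinearMap.coe_sum, Finset.sum_apply] at this
      rw [← this]
      exact hφ v hv
    exact eq_zero_of_sum_mem_weightLine B D (fun d' => ψ d' ⟨monomial v 1, hv⟩) (fun d' _ => hψmem d' v hv) h1
      hd hdc
  have key : ∑ d ∈ D, ψ d ∈ Submodule.span K (Set.range fun j : {j : HomIndex B // j.weight = c} => homBasis B j.1) := by
    refine Submodule.sum_mem _ fun d hd => ?_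
    by_cases hdc : d = c
    · subst hdc
      exact Submodule.sum_mem _ fun j hj =>
        Submodule.smul_mem _ _ (Submodule.subset_span ⟨⟨j, (Finset.mem_filter.1 hj).2⟩, rfl⟩)
    · rw [hzero d hd hdc]
      exact Submodule.zero_mem _
  rwa [← hsum] at key

/-- **THE WEIGHT DECOMPOSITION**: `Hom_R(I_M, R/I_M)_c` is EXACTLY the `K`-span of the monomial branch fields
`σ_{i,a,b}(x^u)` of weight `u − e_b = c`. -/
theorem homWeight_eq_span (B : Blocks ι n) (c : Fin n → ℤ) :
    homWeight K B c = Submodule.span K (Set.range fun j : {j : HomIndex B // j.weight = c} => homBasis B j.1) := by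
  refine le_antisymm (homWeight_le_span B c) (Submodule.span_le.2 ?_)
  rintro _ ⟨⟨j, hj⟩, rfl⟩
  subst hj
  exact homBasis_mem_homWeight B j

/-- Every normal field is a finite sum of weight vectors: `⨆_c Hom_c = ⊤`. -/
theorem iSup_homWeight_eq_top (B : Blocks ι n) : ⨆ c, homWeight K B c = ⊤ := by
  rw [eq_top_iff, ← (homBasis (K := K) B).span_eq, Submodule.span_le]
  rintro _ ⟨j, rfl⟩
  exact Submodule.mem_iSup_of_mem j.weight (homBasis_mem_homWeight B j)

/-- The weight pieces as spans of basis vectors, image form. -/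
theorem homWeight_eq_span_image (B : Blocks ι n) (c : Fin n → ℤ) :
    homWeight K B c = Submodule.span K (homBasis (K := K) B '' {j | j.weight = c}) := by
  rw [Set.image_eq_range]
  exact homWeight_eq_span B c

/-- **The weight pieces are INDEPENDENT** (distinct weights of one basis). -/
theorem iSupIndep_homWeight (B : Blocks ι n) : iSupIndep (homWeight K B) := by
  classical
  rw [iSupIndep_def]
  intro c
  have hsup : ⨆ (d) (_ : d ≠ c), homWeight K B d = Submodule.span K (homBasis (K := K) B '' {j | j.weight ≠ c}) := by
    simp_rw [homWeight_eq_span_image, ← Submodule.span_iUnion₂]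
    congr 1
    ext x
    simp only [Set.mem_iUnion, Set.mem_image, Set.mem_setOf_eq, exists_prop]
    constructor
    · rintro ⟨d, hd, j, hj, rfl⟩
      exact ⟨j, hj ▸ hd, rfl⟩
    · rintro ⟨j, hj, rfl⟩
      exact ⟨j.weight, hj, j, rfl, rfl⟩
  rw [homWeight_eq_span_image, hsup]
  exact (homBasis (K := K) B).linearIndependent.disjoint_span_image
    (Set.disjoint_left.2 fun j hj hj' => hj' hj)

/-- **`Hom_R(I_M, R/I_M) = ⨁_{c ∈ ℤⁿ} Hom_c`** — the weight pieces form an internal direct sum decomposition (the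
`ℤⁿ`-grading of the normal module of the block model). -/
theorem isInternal_homWeight (B : Blocks ι n) : DirectSum.IsInternal (homWeight K B) :=
  (DirectSum.isInternal_submodule_iff_iSupIndep_and_iSup_eq_top _).2
    ⟨iSupIndep_homWeight B, iSup_homWeight_eq_top B⟩

/-! ## Counting: the basis vectors of a given weight -/

/-- The branch data CONTRIBUTING to weight `c`: `c_b = −1`, `c_a = 0`, `c ≥ 0` off `{a, b}` (then the unique basis
vector of weight `c` on the branch `(i, a, b)` is `σ_{i,a,b}(x^u)`, `u = c + e_b`). -/
def Contributes (c : Fin n → ℤ) {B : Blocks ι n} (t : Branch B) : Prop :=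
  c t.1.2.2 = -1 ∧ c t.1.2.1 = 0 ∧ ∀ l, l ≠ t.1.2.1 → l ≠ t.1.2.2 → 0 ≤ c l

/-- `Contributes` is decidable. -/
instance instDecidableContributes (c : Fin n → ℤ) {B : Blocks ι n} (t : Branch B) : Decidable (Contributes c t) := by
  unfold Contributes; infer_instance

/-- The exponent `c + e_b` (clipped to `ℕⁿ`, zero at `a, b`). -/
noncomputable def expOf (c : Fin n → ℤ) (a b : Fin n) : Fin n →₀ ℕ :=
  Finsupp.equivFunOnFinite.symm fun l => if l = a ∨ l = b then 0 else (c l).toNat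

omit [Fintype ι] [DecidableEq ι] in
/-- Its entries. -/
theorem expOf_apply (c : Fin n → ℤ) (a b l : Fin n) :
    expOf c a b l = if l = a ∨ l = b then 0 else (c l).toNat := by
  rw [expOf, Finsupp.coe_equivFunOnFinite_symm]

omit [Fintype ι] [DecidableEq ι] in
/-- Every basis vector `σ_{i,a,b}(x^u)` contributes to its own weight `u − e_b`. -/
theorem HomIndex.contributes {B : Blocks ι n} (j : HomIndex B) : Contributes j.weight j.1 := by
  obtain ⟨t, u, hua, hub⟩ := j
  have hab : t.1.2.1 ≠ t.1.2.2 := fun e => (mem_erase.1 t.2.2).1 e.symm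
  refine ⟨?_, ?_, ?_⟩
  · show (u t.1.2.2 : ℤ) - ((Finsupp.single t.1.2.2 1 : Fin n →₀ ℕ) t.1.2.2 : ℕ) = -1
    rw [Finsupp.single_eq_same, hub]
    simp
  · show (u t.1.2.1 : ℤ) - ((Finsupp.single t.1.2.2 1 : Fin n →₀ ℕ) t.1.2.1 : ℕ) = 0
    rw [Finsupp.single_eq_of_ne hab, hua]
    simp
  · intro l _ hlb
    show (0 : ℤ) ≤ (u l : ℤ) - ((Finsupp.single t.1.2.2 1 : Fin n →₀ ℕ) l : ℕ)
    rw [Finsupp.single_eq_of_ne hlb]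
    simp

/-- The basis index of weight `c` on the branch datum `t`: `σ_t(x^{c + e_b})`. -/
noncomputable def indexOf (c : Fin n → ℤ) {B : Blocks ι n} (t : Branch B) : HomIndex B :=
  ⟨t, ⟨expOf c t.1.2.1 t.1.2.2, by simp [mem_freeExp_iff, expOf_apply]⟩⟩

omit [Fintype ι] [DecidableEq ι] in
/-- On a contributing branch datum it has weight `c`. -/
theorem weight_indexOf {c : Fin n → ℤ} {B : Blocks ι n} {t : Branch B} (ht : Contributes c t) :
    (indexOf c t).weight = c := by
  obtain ⟨hb, ha, hrest⟩ := ht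
  have hab : t.1.2.1 ≠ t.1.2.2 := fun e => (mem_erase.1 t.2.2).1 e.symm
  funext l
  show ((expOf c t.1.2.1 t.1.2.2 l : ℕ) : ℤ) - ((Finsupp.single t.1.2.2 1 : Fin n →₀ ℕ) l : ℕ) = c l
  rw [expOf_apply]
  by_cases hla : l = t.1.2.1
  · subst hla
    rw [if_pos (Or.inl rfl), Finsupp.single_eq_of_ne hab, ha]
    simp
  by_cases hlb : l = t.1.2.2
  · subst hlb
    rw [if_pos (Or.inr rfl), Finsupp.single_eq_same, hb]
    simp
  · rw [if_neg (not_or.2 ⟨hla, hlb⟩), Finsupp.single_eq_of_ne hlb]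
    have := hrest l hla hlb
    simp only [Nat.cast_zero, sub_zero]
    exact Int.toNat_of_nonneg this

omit [Fintype ι] [DecidableEq ι] in
/-- A basis vector of weight `c` IS the index of weight `c` on its branch datum (the exponent is forced). -/
theorem indexOf_eq {c : Fin n → ℤ} {B : Blocks ι n} (j : HomIndex B) (hj : j.weight = c) : indexOf c j.1 = j := by
  obtain ⟨t, u, hua, hub⟩ := j
  subst hj
  refine Sigma.ext rfl (heq_of_eq ?_)
  apply Subtype.ext
  ext l
  show expOf _ t.1.2.1 t.1.2.2 l = u l
  rw [expOf_apply]
  by_cases hla : l = t.1.2.1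
  · subst hla
    rw [if_pos (Or.inl rfl), hua]
  by_cases hlb : l = t.1.2.2
  · subst hlb
    rw [if_pos (Or.inr rfl), hub]
  · rw [if_neg (not_or.2 ⟨hla, hlb⟩)]
    show ((u l : ℤ) - ((Finsupp.single t.1.2.2 1 : Fin n →₀ ℕ) l : ℕ)).toNat = u l
    rw [Finsupp.single_eq_of_ne hlb]
    simp

/-- **The basis vectors of weight `c` ↔ the contributing branch data.** -/
noncomputable def weightFiberEquiv (B : Blocks ι n) (c : Fin n → ℤ) :
    {j : HomIndex B // j.weight = c} ≃ {t : Branch B // Contributes c t} where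
  toFun j := ⟨j.1.1, by have h := j.1.contributes; rwa [j.2] at h⟩
  invFun t := ⟨indexOf c t.1, weight_indexOf t.2⟩
  left_inv j := Subtype.ext (indexOf_eq j.1 j.2)
  right_inv _ := Subtype.ext rfl

/-- The weight fibers of the basis are finite. -/
noncomputable instance fintypeWeightFiber (B : Blocks ι n) (c : Fin n → ℤ) : Fintype {j : HomIndex B // j.weight = c} :=
  Fintype.ofEquiv _ (weightFiberEquiv B c).symm

/-- **THE WEIGHT COUNT (EXT-NOTE §6.B(a), machine-check column, as a theorem for every `n`, every block model, every
multidegree):** `dim_K Hom_R(I_M, R/I_M)_c = #{branch data (i, a, b) : c_b = −1, c_a = 0, c_l ≥ 0 (l ≠ a, b)}`. -/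
theorem finrank_homWeight [Nontrivial K] (B : Blocks ι n) (c : Fin n → ℤ) :
    Module.finrank K (homWeight K B c) = Fintype.card {t : Branch B // Contributes c t} := by
  classical
  have hli : LinearIndependent K fun j : {j : HomIndex B // j.weight = c} => homBasis (K := K) B j.1 :=
    (homBasis (K := K) B).linearIndependent.comp _ Subtype.val_injective
  rw [homWeight_eq_span, finrank_span_eq_card hli, Fintype.card_congr (weightFiberEquiv B c)]

/-- An EMPTY fiber: no branch datum contributes ⇒ `Hom_c = 0` (any coefficient ring). -/
theorem homWeight_eq_bot_of_not_contributes (B : Blocks ι n) {c : Fin n → ℤ} (h : ∀ t : Branch B, ¬ Contributes c t) :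
    homWeight K B c = ⊥ := by
  rw [homWeight_eq_span, Submodule.span_eq_bot]
  rintro _ ⟨⟨j, hj⟩, rfl⟩
  exact absurd (by have h' := j.contributes; rwa [hj] at h') (h j.1)

/-- **«NO POLES», degree by degree (1): no weight with an entry `≤ −2`** — a normal field lowers each exponent by at
most one. -/
theorem homWeight_eq_bot_of_le (B : Blocks ι n) {c : Fin n → ℤ} {l : Fin n} (hl : c l ≤ -2) : homWeight K B c = ⊥ :=
  homWeight_eq_bot_of_not_contributes B fun t ht => by
    obtain ⟨hb, ha, hrest⟩ := ht
    by_cases hlb : l = t.1.2.2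
    · subst hlb; omega
    by_cases hla : l = t.1.2.1
    · subst hla; omega
    · have := hrest l hla hlb; omega

/-- **«NO POLES», degree by degree (2): no weight with two negative entries** — a normal field lowers at most ONE
exponent (EXT-NOTE §6.B(a)(ii)–(iii): «at most simple poles, along one variable» and then none). -/
theorem homWeight_eq_bot_of_two_neg (B : Blocks ι n) {c : Fin n → ℤ} {l m : Fin n} (hlm : l ≠ m) (hl : c l < 0)
    (hm : c m < 0) : homWeight K B c = ⊥ :=
  homWeight_eq_bot_of_not_contributes B fun t ht => by
    obtain ⟨hb, ha, hrest⟩ := ht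
    have key : ∀ k, c k < 0 → k = t.1.2.2 := by
      intro k hk
      by_contra hkb
      by_cases hka : k = t.1.2.1
      · subst hka; omega
      · have := hrest k hka hkb; omega
    exact hlm ((key l hl).trans (key m hm).symm)

/-- **No non-negative weights**: every normal field LOWERS some exponent (`Hom_c = 0` unless some `c_b = −1`; in
particular `Hom_0 = 0`). -/
theorem homWeight_eq_bot_of_nonneg (B : Blocks ι n) {c : Fin n → ℤ} (hc : ∀ l, 0 ≤ c l) : homWeight K B c = ⊥ :=
  homWeight_eq_bot_of_not_contributes B fun t ht => by have := hc t.1.2.2; have := ht.1; omega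

/-! ## The column `Σ_l dim Hom_{−e_l} = 2 · #components` -/

/-- The multidegree `−e_l`. -/
noncomputable def negSingle (l : Fin n) : Fin n → ℤ := fun j => -((Finsupp.single l 1 : Fin n →₀ ℕ) j : ℤ)

omit [Fintype ι] [DecidableEq ι] in
/-- `(i, a, b)` contributes to the weight `−e_l` iff `b = l` (the normal field `∂_l` on the component `V(x_a, x_l)`). -/
theorem contributes_negSingle_iff {B : Blocks ι n} (l : Fin n) (t : Branch B) :
    Contributes (negSingle l) t ↔ t.1.2.2 = l := by
  have hab : t.1.2.1 ≠ t.1.2.2 := fun e => (mem_erase.1 t.2.2).1 e.symm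
  constructor
  · rintro ⟨hb, -, -⟩
    by_contra h
    rw [negSingle, Finsupp.single_eq_of_ne h] at hb
    simp at hb
  · intro h
    subst h
    refine ⟨?_, ?_, ?_⟩
    · simp [negSingle]
    · rw [negSingle, Finsupp.single_eq_of_ne hab]
      simp
    · intro l' _ hl'
      rw [negSingle, Finsupp.single_eq_of_ne hl']
      simp

omit [Fintype ι] [DecidableEq ι] in
/-- Branch data ending at `l ∈ S_i` ↔ their first coordinate `a ∈ S_i ∖ l` (blocks are disjoint, so the block is `i`). -/
noncomputable def branchEndEquiv (B : Blocks ι n) {i : ι} {l : Fin n} (hl : l ∈ B.S i) :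
    {t : Branch B // t.1.2.2 = l} ≃ ↥((B.S i).erase l) where
  toFun t := ⟨t.1.1.2.1, by
    obtain ⟨⟨p, ha, hb⟩, hbl⟩ := t
    have hbl' : p.2.2 = l := hbl
    have hi : p.1 = i := by
      by_contra hne
      exact Finset.disjoint_left.1 (B.disjoint hne) (mem_of_mem_erase hb) (by rw [hbl']; exact hl)
    subst hbl' hi
    exact mem_erase.2 ⟨fun h => (mem_erase.1 hb).1 h.symm, ha⟩⟩
  invFun a := ⟨⟨(i, a.1, l), mem_of_mem_erase a.2, mem_erase.2 ⟨fun h => (mem_erase.1 a.2).1 h.symm, hl⟩⟩, rfl⟩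
  left_inv t := by
    obtain ⟨⟨p, ha, hb⟩, hbl⟩ := t
    have hbl' : p.2.2 = l := hbl
    have hi : p.1 = i := by
      by_contra hne
      exact Finset.disjoint_left.1 (B.disjoint hne) (mem_of_mem_erase hb) (by rw [hbl']; exact hl)
    apply Subtype.ext
    apply Subtype.ext
    show (i, p.2.1, l) = p
    rw [← hi, ← hbl']
  right_inv _ := rfl

/-- **`dim_K Hom_{−e_l} = |S_i| − 1` for `l ∈ S_i`** (the fields `∂_l` on the `|S_i| − 1` components `V(x_a, x_l)`,
`a ∈ S_i ∖ l`). -/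
theorem finrank_homWeight_negSingle_of_mem [Nontrivial K] (B : Blocks ι n) {i : ι} {l : Fin n} (hl : l ∈ B.S i) :
    Module.finrank K (homWeight K B (negSingle l)) = (B.S i).card - 1 := by
  rw [finrank_homWeight, Fintype.card_congr ((Equiv.subtypeEquivRight (contributes_negSingle_iff l)).trans
    (branchEndEquiv B hl)), Fintype.card_coe, Finset.card_erase_of_mem hl]

/-- **`Hom_{−e_l} = 0` if `x_l` is a free coordinate** (in no block). -/
theorem finrank_homWeight_negSingle_of_notMem [Nontrivial K] (B : Blocks ι n) {l : Fin n} (hl : ∀ i, l ∉ B.S i) :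
    Module.finrank K (homWeight K B (negSingle l)) = 0 := by
  rw [finrank_homWeight, Fintype.card_eq_zero_iff]
  refine ⟨fun t => hl t.1.1.1 ?_⟩
  have h := (contributes_negSingle_iff l t.1).1 t.2
  have := mem_of_mem_erase t.1.2.2
  rwa [h] at this

/-- **THE MACHINE-CHECK COLUMN `Σ_l dim_K Hom_R(I_M, R/I_M)_{−e_l} = Σ_i |S_i| (|S_i| − 1) = 2 · #components`**
(EXT-NOTE §6.B(a): «6, 12, 20, 30 | 4, 8, 12, 6, 18» for `K_3, K_4, K_5, K_6 | K_2⊔K_2, K_3⊔K_2, K_3⊔K_3,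
K_2⊔K_2⊔K_2, K_4⊔K_3`) — now for every block model and every `n`. -/
theorem sum_finrank_homWeight_negSingle [Nontrivial K] (B : Blocks ι n) :
    ∑ l, Module.finrank K (homWeight K B (negSingle l)) = ∑ i, (B.S i).card * ((B.S i).card - 1) := by
  rw [← card_branch B]
  simp_rw [finrank_homWeight]
  rw [← Fintype.card_sigma]
  exact Fintype.card_congr ((Equiv.sigmaCongrRight fun l => Equiv.subtypeEquivRight
    (contributes_negSingle_iff (B := B) l)).trans (Equiv.sigmaFiberEquiv fun t : Branch B => t.1.2.2))

/-- ONE BLOCK `S = [n]` (the SR design `W` of files VIII/IX; `n ≥ 1`): **`dim_K Hom_R(I_W, R/I_W)_{−e_l} = n − 1` for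
every `l`** (the fields `∂_l` on the `n − 1` components `B_{al}`, `a ≠ l`). -/
theorem finrank_homWeight_negSingle_full [Nontrivial K] (hn : (univ : Finset (Fin n)).Nonempty) (l : Fin n) :
    Module.finrank K (homWeight K (Blocks.single univ hn) (negSingle l)) = n - 1 := by
  rw [finrank_homWeight_negSingle_of_mem (Blocks.single univ hn) (i := ()) (Finset.mem_univ l)]
  show (univ : Finset (Fin n)).card - 1 = n - 1
  rw [Finset.card_univ, Fintype.card_fin]

/-- ONE BLOCK `S = [n]`: **`Σ_l dim_K Hom_R(I_W, R/I_W)_{−e_l} = n(n − 1) = h(W)`** (EXT-NOTE §6.C(1): `2, 6, 12, 20, 30`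
for `n = 2, …, 6`). -/
theorem sum_finrank_homWeight_negSingle_full [Nontrivial K] (hn : (univ : Finset (Fin n)).Nonempty) :
    ∑ l, Module.finrank K (homWeight K (Blocks.single univ hn) (negSingle l)) = n * (n - 1) := by
  rw [Finset.sum_congr rfl fun l _ => finrank_homWeight_negSingle_full (K := K) hn l, Finset.sum_const,
    Finset.card_univ, Fintype.card_fin, smul_eq_mul]

end Summit.Ventures.HSemireg.ObstructionLocus.BlockModel
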